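import Literature.AlgebraicGeometry.Resolution.NeronPopescuLocalTricks
import Mathlib.RingTheory.Smooth.Locus
import Mathlib.RingTheory.TensorProduct.Basic
import Mathlib.RingTheory.FinitePresentation
import HarnessLib

/-!
# The algebra `B = A[x_1, …, x_d, z_{ij}]/(x_iⁿ - Σ_j z_{ij} a_j)` of the proof of Stacks 07FE

Topic: `Literature/AlgebraicGeometry/Resolution`. Support file of the INLINE proof of the named
fact `Stacks07FE_resolveSpecial` (`NeronPopescuSteps.lean`). The printed proof of 07FE begins:
"Set `R = k[x_1, …, x_d]` … Choose generators `a_1, …, a_r` of `H_{A/R}` [sic, `H_{A/k}`].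
Set `B = A[x_1, …, x_d, z_{ij}]/(x_iⁿ - Σ z_{ij} a_j)`. Each `B_{a_j}` is smooth over `R` it
is a polynomial algebra over `A_{a_j}[x_1, …, x_d]` and `A_{a_j}` is smooth over `k`. Hence
`B_{x_i}` is smooth over `R`. … Write `π_iⁿ = Σ λ_{ij} a_j` … Consider the map `B → Λ`
defined by `x_i ↦ π_i` and `z_{ij} ↦ λ_{ij}`." This file DEFINES this algebra and PROVES those
claims (sorry-free, no named facts):

* `Stacks07FE.relation`, `Stacks07FE.B a n d` (for `a : Fin r → A`, exponent `n`, `d`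
  variables `x`), `Stacks07FE.var` (the classes of the variables), its `A`-, `k`- and
  `k[x_1, …, x_d]`-algebra structures (`x_i ↦ x_i`, `Stacks07FE.algebraMvPolynomial`),
  `Stacks07FE.var_pow_eq` (the relation), `Stacks07FE.finitePresentation` (over `k[x]`);
* `Stacks07FE.lift φ π λ h : B →ₐ[k] Λ` for `φ : A → Λ`, `π_iⁿ = Σ_j λ_{ij} φ(a_j)`, with
  `lift_algebraMap`, `lift_var_inl`, `lift_var_inr`, `lift_algebraMap_mvPolynomial` (it is a
  map of `k[x]`-algebras for `x_i ↦ π_i` on `Λ`);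
* `Stacks07FE.smooth_away_algebraMap` — `B_{a_j}` is smooth over `R = k[x]` when `A_{a_j}`
  is smooth over `k` (shown as a retract of the smooth `R`-algebra `(R ⊗_k A_{a_j})[z]`,
  `z_{ij} ↦ (x_iⁿ - Σ_{j' ≠ j} z_{ij'} a_{j'})/a_j`, via `smooth_away_of_retract` of
  `NeronPopescuLocalTricks.lean`);
* `Stacks07FE.smooth_away_var_inl` — hence `B_{x_i}` is smooth over `R` (`D(x_i)` is covered
  by the `D(a_j)`; Mathlib's smooth locus).

## Sources

* The Stacks Project, *Smoothing Ring Maps* (Tag 07BW), proof of Lemma 07FE. [StacksProject]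
-/

noncomputable section

namespace Literature.AlgebraicGeometry.Resolution

universe u v

open MvPolynomial TensorProduct

/-! ## The algebra `B = A[x, z]/(x_iⁿ - Σ_j z_{ij} a_j)` of the proof of 07FE -/

namespace Stacks07FE

variable {k : Type u} [CommRing k] {A : Type u} [CommRing A] [Algebra k A]
  {r : ℕ} (a : Fin r → A) (n d : ℕ)

/-- The relations `x_iⁿ - Σ_j z_{ij} a_j` of the algebra `B` of the proof of Stacks 07FE
(variables `x_i`, `i < d`, and `z_{ij}`). [cite: StacksProject, Tag 07FE (proof)] -/
def relation (i : Fin d) : MvPolynomial (Fin d ⊕ (Fin d × Fin r)) A :=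
  MvPolynomial.X (Sum.inl i) ^ n - ∑ j, MvPolynomial.X (Sum.inr (i, j)) * MvPolynomial.C (a j)

/-- The algebra `B = A[x_1, …, x_d, z_{ij}]/(x_iⁿ - Σ_j z_{ij} a_j)` of the proof of Stacks
07FE ("Choose generators `a_1, …, a_r` of `H_{A/k}`. Set `B = A[x_1, …, x_d, z_{ij}]/
(x_iⁿ - Σ z_{ij} a_j)`"). [cite: StacksProject, Tag 07FE (proof)] -/
def B : Type u :=
  MvPolynomial (Fin d ⊕ (Fin d × Fin r)) A ⧸ Ideal.span (Set.range (relation a n d))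

/-- `B` is a commutative ring (a quotient of a polynomial ring over `A`). -/
instance : CommRing (B a n d) := inferInstanceAs (CommRing (_ ⧸ _))

/-- `B` is an `A`-algebra. -/
instance : Algebra A (B a n d) := inferInstanceAs (Algebra A (_ ⧸ _))

/-- `B` is a `k`-algebra. -/
instance : Algebra k (B a n d) := inferInstanceAs (Algebra k (_ ⧸ _))

/-- `k → A → B` is a scalar tower. -/
instance : IsScalarTower k A (B a n d) := inferInstanceAs (IsScalarTower k A (_ ⧸ _))

/-- The variables `x_i` (`Sum.inl i`) and `z_{ij}` (`Sum.inr (i, j)`) of `B`.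
[cite: StacksProject, Tag 07FE (proof)] -/
def var (v : Fin d ⊕ (Fin d × Fin r)) : B a n d := Ideal.Quotient.mk _ (MvPolynomial.X v)

/-- `B` as an algebra over `R = k[x_1, …, x_d]`, through `x_i ↦ x_i`.
[cite: StacksProject, Tag 07FE (proof)] -/
instance algebraMvPolynomial : Algebra (MvPolynomial (Fin d) k) (B a n d) :=
  (MvPolynomial.aeval fun i => var a n d (Sum.inl i)).toRingHom.toAlgebra

/-- The structure map `k[x] → B` is evaluation at the `x_i`. [folklore] -/
theorem algebraMap_mvPolynomial (p : MvPolynomial (Fin d) k) :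
    algebraMap (MvPolynomial (Fin d) k) (B a n d) p =
      MvPolynomial.aeval (fun i => var a n d (Sum.inl i)) p := rfl

/-- `k → k[x] → B` is a scalar tower. -/
instance : IsScalarTower k (MvPolynomial (Fin d) k) (B a n d) :=
  IsScalarTower.of_algebraMap_eq fun c => by
    rw [algebraMap_mvPolynomial, MvPolynomial.algebraMap_eq, MvPolynomial.aeval_C]

variable {a n d}

/-- The relations vanish in `B`. [folklore] -/
theorem mk_relation (i : Fin d) :
    (Ideal.Quotient.mk (Ideal.span (Set.range (relation a n d))) (relation a n d i) : B a n d) = 0 :=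
  Ideal.Quotient.eq_zero_iff_mem.mpr (Ideal.subset_span ⟨i, rfl⟩)

/-- The defining relation in `B`: `x_iⁿ = Σ_j z_{ij} a_j`. [cite: StacksProject, Tag 07FE (proof)] -/
theorem var_pow_eq (i : Fin d) :
    var a n d (Sum.inl i) ^ n = ∑ j, var a n d (Sum.inr (i, j)) * algebraMap A (B a n d) (a j) := by
  have h := mk_relation (a := a) (n := n) (d := d) i
  simp only [relation, map_sub, map_sum, map_mul, map_pow] at h
  rw [sub_eq_zero] at h
  exact h

variable (a n d) in
/-- `B` is finitely presented over `A`. [folklore] -/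
theorem finitePresentation_A : Algebra.FinitePresentation A (B a n d) := by
  classical
  have hfg : (Ideal.span (Set.range (relation a n d))).FG :=
    ⟨Finset.univ.image (relation a n d), by rw [Finset.coe_image, Finset.coe_univ, Set.image_univ]⟩
  exact Algebra.FinitePresentation.quotient hfg

variable (a n d) in
/-- `B` is finitely presented over `R = k[x]` (for `A` finitely presented over `k`).
[cite: StacksProject, Tag 07FE (proof)] -/
theorem finitePresentation [Algebra.FinitePresentation k A] :
    Algebra.FinitePresentation (MvPolynomial (Fin d) k) (B a n d) := by
  haveI := finitePresentation_A a n d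
  haveI : Algebra.FinitePresentation k (B a n d) := Algebra.FinitePresentation.trans k A (B a n d)
  exact Algebra.FinitePresentation.of_restrict_scalars_finitePresentation k _ _

section lift

variable {Λ : Type v} [CommRing Λ] [Algebra k Λ] (φ : A →ₐ[k] Λ) (π : Fin d → Λ)
  (lam : Fin d → Fin r → Λ) (hπ : ∀ i, π i ^ n = ∑ j, lam i j * φ (a j))

/-- The map `B → Λ`, `x_i ↦ π_i`, `z_{ij} ↦ λ_{ij}` extending `φ : A → Λ`, defined by
`π_iⁿ = Σ λ_{ij} φ(a_j)` ("Write `π_iⁿ = Σ λ_{ij} a_j` … Consider the map `B → Λ` defined by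
`x_i ↦ π_i` and `z_{ij} ↦ λ_{ij}`"). [cite: StacksProject, Tag 07FE (proof)] -/
def lift : B a n d →ₐ[k] Λ :=
  Ideal.Quotient.liftₐ _ (MvPolynomial.aevalTower φ (Sum.elim π fun p => lam p.1 p.2)) (by
    intro x hx
    rw [← RingHom.mem_ker]
    refine (Ideal.span_le.mpr ?_) hx
    rintro _ ⟨i, rfl⟩
    rw [SetLike.mem_coe, RingHom.mem_ker]
    change MvPolynomial.aevalTower φ _ (relation a n d i) = 0
    simp only [relation, map_sub, map_sum, map_mul, map_pow, MvPolynomial.aevalTower_X,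
      MvPolynomial.aevalTower_C, Sum.elim_inl, Sum.elim_inr, hπ i, sub_self])

/-- `lift` extends `φ`. [folklore] -/
theorem lift_algebraMap (x : A) : lift φ π lam hπ (algebraMap A (B a n d) x) = φ x :=
  MvPolynomial.aevalTower_C _ _ _

/-- `lift` sends `x_i ↦ π_i`. [folklore] -/
theorem lift_var_inl (i : Fin d) : lift φ π lam hπ (var a n d (Sum.inl i)) = π i :=
  MvPolynomial.aevalTower_X _ _ _

/-- `lift` sends `z_{ij} ↦ λ_{ij}`. [folklore] -/
theorem lift_var_inr (i : Fin d) (j : Fin r) : lift φ π lam hπ (var a n d (Sum.inr (i, j))) = lam i j :=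
  MvPolynomial.aevalTower_X _ _ _

/-- `B → Λ` is a map of `k[x]`-algebras for `x_i ↦ π_i` on `Λ`. [folklore] -/
theorem lift_algebraMap_mvPolynomial (p : MvPolynomial (Fin d) k) :
    lift φ π lam hπ (algebraMap (MvPolynomial (Fin d) k) (B a n d) p) = MvPolynomial.aeval π p := by
  rw [algebraMap_mvPolynomial, ← AlgHom.comp_apply]
  congr 1
  apply MvPolynomial.algHom_ext
  intro i
  rw [AlgHom.comp_apply, MvPolynomial.aeval_X, MvPolynomial.aeval_X, lift_var_inl]

end lift

section smooth

variable [Algebra.FinitePresentation k A]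

/-- **`B_{a_j}` is smooth over `R = k[x]`** ("Each `B_{a_j}` is smooth over `R`: it is a
polynomial algebra over `A_{a_j}[x_1, …, x_d]` and `A_{a_j}` is smooth over `k`"). Here `B_{a_j}`
is exhibited as a retract of the smooth `R`-algebra `(R ⊗_k A_{a_j})[z]`, the variable
`z_{ij}` going to `(x_iⁿ - Σ_{j' ≠ j} z_{ij'} a_{j'})/a_j`. [cite: StacksProject, Tag 07FE (proof)] -/
theorem smooth_away_algebraMap (j₀ : Fin r) (hj₀ : Algebra.Smooth k (Localization.Away (a j₀))) :
    Algebra.Smooth (MvPolynomial (Fin d) k)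
      (Localization.Away (algebraMap A (B a n d) (a j₀))) := by
  classical
  set R := MvPolynomial (Fin d) k with hR
  haveI : Algebra.FinitePresentation R (B a n d) := finitePresentation a n d
  set b : B a n d := algebraMap A (B a n d) (a j₀) with hb
  let Bb := Localization.Away b
  let Aa := Localization.Away (a j₀)
  haveI : Algebra.Smooth k Aa := hj₀
  let RA := R ⊗[k] Aa
  let S := MvPolynomial (Fin d × Fin r) RA
  haveI : Algebra.Smooth RA S := ⟨inferInstance, inferInstance⟩
  haveI : Algebra.Smooth R S := Algebra.Smooth.comp R RA S
  -- `A → A_{a} → R ⊗ A_{a} → S`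
  let ιA : A →ₐ[k] S := (IsScalarTower.toAlgHom k RA S).comp
    ((Algebra.TensorProduct.includeRight : Aa →ₐ[k] RA).comp (IsScalarTower.toAlgHom k A Aa))
  have hιA : ∀ x, ιA x = algebraMap RA S ((1 : R) ⊗ₜ[k] algebraMap A Aa x) := fun x => rfl
  have hιAu : IsUnit (ιA (a j₀)) := by
    rw [hιA]
    exact (((IsLocalization.Away.algebraMap_isUnit (a j₀)).map
      (Algebra.TensorProduct.includeRight : Aa →ₐ[k] RA)).map (algebraMap RA S))
  let aSi : S := ((hιAu.unit⁻¹ : Sˣ) : S)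
  have haSi : ιA (a j₀) * aSi = 1 := hιAu.mul_val_inv
  -- the images of the variables in `S`
  let xS : Fin d → S := fun i => algebraMap R S (MvPolynomial.X i)
  let solve : Fin d → S := fun i =>
    (xS i ^ n - ∑ j ∈ Finset.univ.erase j₀, MvPolynomial.X (i, j) * ιA (a j)) * aSi
  let zS : Fin d × Fin r → S := fun p => if p.2 = j₀ then solve p.1 else MvPolynomial.X p
  let wS : Fin d ⊕ (Fin d × Fin r) → S := Sum.elim xS zS
  let Φ₀ : MvPolynomial (Fin d ⊕ (Fin d × Fin r)) A →ₐ[k] S := MvPolynomial.aevalTower ιA wS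
  have hΦ₀C : ∀ x, Φ₀ (MvPolynomial.C x) = ιA x := fun x => MvPolynomial.aevalTower_C _ _ _
  have hΦ₀X : ∀ v, Φ₀ (MvPolynomial.X v) = wS v := fun v => MvPolynomial.aevalTower_X _ _ _
  have hΦ₀rel : ∀ i, Φ₀ (relation a n d i) = 0 := fun i => by
    simp only [relation, map_sub, map_sum, map_mul, map_pow, hΦ₀C, hΦ₀X]
    change xS i ^ n - ∑ j, zS (i, j) * ιA (a j) = 0
    rw [← Finset.add_sum_erase _ _ (Finset.mem_univ j₀)]
    have h1 : zS (i, j₀) = solve i := if_pos rfl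
    have h2 : ∀ j ∈ Finset.univ.erase j₀, zS (i, j) = MvPolynomial.X (i, j) := fun j hj =>
      if_neg (Finset.ne_of_mem_erase hj)
    rw [h1, Finset.sum_congr rfl fun j hj => by rw [h2 j hj]]
    simp only [solve]
    rw [mul_assoc, mul_comm aSi, haSi, mul_one, sub_add_cancel, sub_self]
  let Φ₁ : B a n d →ₐ[k] S := Ideal.Quotient.liftₐ _ Φ₀ (by
    intro x hx
    rw [← RingHom.mem_ker]
    refine (Ideal.span_le.mpr ?_) hx
    rintro _ ⟨i, rfl⟩
    exact hΦ₀rel i)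
  have hΦ₁ : ∀ p, Φ₁ (Ideal.Quotient.mk _ p) = Φ₀ p := fun p => rfl
  have hΦ₁b : Φ₁ b = ιA (a j₀) := by
    change Φ₁ (Ideal.Quotient.mk _ (MvPolynomial.C (a j₀))) = _
    rw [hΦ₁, hΦ₀C]
  have hΦ₁u : ∀ y : Submonoid.powers b, IsUnit (Φ₁ y) := by
    rintro ⟨y, m, rfl⟩
    rw [map_pow, hΦ₁b]
    exact hιAu.pow m
  let Φk : Bb →ₐ[k] S := IsLocalization.liftAlgHom hΦ₁u
  have hΦk : ∀ x : B a n d, Φk (algebraMap (B a n d) Bb x) = Φ₁ x := fun x =>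
    IsLocalization.lift_eq hΦ₁u x
  have hΦkR : ∀ p : R, Φk (algebraMap R Bb p) = algebraMap R S p := by
    intro p
    have : (Φk.comp (IsScalarTower.toAlgHom k R Bb) : R →ₐ[k] S) = IsScalarTower.toAlgHom k R S := by
      apply MvPolynomial.algHom_ext
      intro i
      rw [AlgHom.comp_apply, IsScalarTower.coe_toAlgHom', IsScalarTower.coe_toAlgHom',
        IsScalarTower.algebraMap_apply R (B a n d) Bb, algebraMap_mvPolynomial,
        MvPolynomial.aeval_X, hΦk]
      change Φ₁ (Ideal.Quotient.mk _ (MvPolynomial.X (Sum.inl i))) = _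
      rw [hΦ₁, hΦ₀X]
      rfl
    exact AlgHom.congr_fun this p
  let Φ : Bb →ₐ[R] S := { toRingHom := Φk.toRingHom, commutes' := hΦkR }
  -- `Ψ : S → B_b`
  have hbunit : IsUnit (algebraMap (B a n d) Bb b) := IsLocalization.Away.algebraMap_isUnit b
  have hAa : ∀ y : Submonoid.powers (a j₀), IsUnit ((IsScalarTower.toAlgHom k A Bb) y) := by
    rintro ⟨y, m, rfl⟩
    rw [map_pow]
    refine IsUnit.pow m ?_
    change IsUnit (algebraMap A Bb (a j₀))
    rw [IsScalarTower.algebraMap_apply A (B a n d) Bb]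
    exact hbunit
  let ΨAa : Aa →ₐ[k] Bb := IsLocalization.liftAlgHom hAa
  have hΨAa : ∀ x : A, ΨAa (algebraMap A Aa x) = algebraMap A Bb x := fun x =>
    IsLocalization.lift_eq hAa x
  let Ψ₀ : RA →ₐ[R] Bb := Algebra.TensorProduct.lift (Algebra.ofId R Bb) ΨAa fun _ _ => Commute.all _ _
  have hΨ₀ : ∀ (p : R) (y : Aa), Ψ₀ (p ⊗ₜ[k] y) = algebraMap R Bb p * ΨAa y := fun p y =>
    Algebra.TensorProduct.lift_tmul _ _ _ p y
  let Ψ : S →ₐ[R] Bb := MvPolynomial.aevalTower Ψ₀ fun p => algebraMap (B a n d) Bb (var a n d (Sum.inr p))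
  have hΨC : ∀ x, Ψ (MvPolynomial.C x) = Ψ₀ x := fun x => MvPolynomial.aevalTower_C _ _ _
  have hΨX : ∀ p, Ψ (MvPolynomial.X p) = algebraMap (B a n d) Bb (var a n d (Sum.inr p)) := fun p =>
    MvPolynomial.aevalTower_X _ _ _
  have hΨιA : ∀ x : A, Ψ (ιA x) = algebraMap A Bb x := fun x => by
    rw [hιA]
    change Ψ (MvPolynomial.C ((1 : R) ⊗ₜ[k] algebraMap A Aa x)) = _
    rw [hΨC, hΨ₀, map_one, one_mul, hΨAa]
  have hΨxS : ∀ i, Ψ (xS i) = algebraMap (B a n d) Bb (var a n d (Sum.inl i)) := fun i => by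
    change Ψ (algebraMap R S (MvPolynomial.X i)) = _
    rw [Ψ.commutes, IsScalarTower.algebraMap_apply R (B a n d) Bb, algebraMap_mvPolynomial,
      MvPolynomial.aeval_X]
  -- `Ψ ∘ Φ = id`
  have hΨsolve : ∀ i, Ψ (solve i) = algebraMap (B a n d) Bb (var a n d (Sum.inr (i, j₀))) := by
    intro i
    have hrel : algebraMap (B a n d) Bb (var a n d (Sum.inl i)) ^ n =
        algebraMap (B a n d) Bb (var a n d (Sum.inr (i, j₀))) * algebraMap A Bb (a j₀) +
          ∑ j ∈ Finset.univ.erase j₀,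
            algebraMap (B a n d) Bb (var a n d (Sum.inr (i, j))) * algebraMap A Bb (a j) := by
      have h := congrArg (algebraMap (B a n d) Bb) (var_pow_eq (a := a) (n := n) (d := d) i)
      simp only [map_pow, map_sum, map_mul] at h
      rw [← Finset.add_sum_erase _ _ (Finset.mem_univ j₀)] at h
      simp only [← IsScalarTower.algebraMap_apply A (B a n d) Bb] at h
      exact h
    have hΨaSi : Ψ aSi * algebraMap A Bb (a j₀) = 1 := by
      rw [← hΨιA, ← map_mul, mul_comm, haSi, map_one]
    simp only [solve, map_mul, map_sub, map_sum, map_pow, hΨxS, hΨX, hΨιA]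
    rw [hrel, add_sub_cancel_right, mul_assoc, mul_comm (algebraMap A Bb (a j₀)), hΨaSi, mul_one]
  have hΨΦ : Ψ.comp Φ = AlgHom.id R Bb := by
    apply AlgHom.coe_ringHom_injective
    refine IsLocalization.ringHom_ext (Submonoid.powers b) ?_
    refine Ideal.Quotient.ringHom_ext ?_
    apply MvPolynomial.ringHom_ext
    · intro x
      change Ψ (Φk (algebraMap (B a n d) Bb (Ideal.Quotient.mk _ (MvPolynomial.C x)))) =
        algebraMap (B a n d) Bb (Ideal.Quotient.mk _ (MvPolynomial.C x))
      rw [hΦk, hΦ₁, hΦ₀C, hΨιA, IsScalarTower.algebraMap_apply A (B a n d) Bb]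
      rfl
    · intro v
      change Ψ (Φk (algebraMap (B a n d) Bb (Ideal.Quotient.mk _ (MvPolynomial.X v)))) =
        algebraMap (B a n d) Bb (Ideal.Quotient.mk _ (MvPolynomial.X v))
      rw [hΦk, hΦ₁, hΦ₀X]
      rcases v with i | ⟨i, j⟩
      · exact hΨxS i
      · change Ψ (zS (i, j)) = algebraMap (B a n d) Bb (var a n d (Sum.inr (i, j)))
        by_cases hj : j = j₀
        · subst hj
          rw [show zS (i, j) = solve i from if_pos rfl]
          exact hΨsolve i
        · rw [show zS (i, j) = MvPolynomial.X (i, j) from if_neg hj]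
          exact hΨX (i, j)
  exact smooth_away_of_retract b S Φ Ψ hΨΦ

/-- **`B_{x_i}` is smooth over `R`** ("Hence `B_{x_i}` is smooth over `R`"): `D(x_i)` is covered
by the `D(a_j)`, as `x_iⁿ = Σ z_{ij} a_j`. [cite: StacksProject, Tag 07FE (proof)] -/
theorem smooth_away_var_inl (ha : ∀ j, Algebra.Smooth k (Localization.Away (a j))) (i : Fin d) :
    Algebra.Smooth (MvPolynomial (Fin d) k) (Localization.Away (var a n d (Sum.inl i))) := by
  haveI : Algebra.FinitePresentation (MvPolynomial (Fin d) k) (B a n d) := finitePresentation a n d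
  rw [← Algebra.basicOpen_subset_smoothLocus_iff_smooth]
  intro P hP
  rw [SetLike.mem_coe, PrimeSpectrum.mem_basicOpen] at hP
  -- `x_iⁿ = Σ z_{ij} a_j`, so some `a_j ∉ P`
  have hex : ∃ j, algebraMap A (B a n d) (a j) ∉ P.asIdeal := by
    by_contra h
    push Not at h
    apply hP
    have hmem : var a n d (Sum.inl i) ^ n ∈ P.asIdeal := by
      rw [var_pow_eq]
      exact P.asIdeal.sum_mem fun j _ => P.asIdeal.mul_mem_left _ (h j)
    exact P.2.mem_of_pow_mem n hmem
  obtain ⟨j, hj⟩ := hex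
  have hsub := (Algebra.basicOpen_subset_smoothLocus_iff_smooth (R := MvPolynomial (Fin d) k)).mpr
    (smooth_away_algebraMap (a := a) (n := n) (d := d) j (ha j))
  exact hsub (show P ∈ (↑(PrimeSpectrum.basicOpen (algebraMap A (B a n d) (a j))) :
    Set (PrimeSpectrum (B a n d))) from (PrimeSpectrum.mem_basicOpen _ _).mpr hj)

end smooth

end Stacks07FE

end Literature.AlgebraicGeometry.Resolution

end
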